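import Mathlib
import Literature.Analysis.SpecialFunctions.DigammaGauss
import Literature.Analysis.SpecialFunctions.PolygammaSeries
import Literature.Barriers.RiemannHypothesis.MollifierLimitationsLemma2Proofs

/-!
# Stirling's asymptotic series for the complex digamma function with an explicit remainder of every order

Topic `Literature/Analysis/SpecialFunctions`, namespace `Literature.Analysis.SpecialFunctions.Complex`
(sibling of `DigammaGauss.lean` — Gauss's formula `ψ(w) = lim (log n − Σ_{j≤n} 1/(w+j))` — and of
`DigammaStirlingSecondOrder.lean`, the case `ν = 0` done by the trapezoid rule).  Everything is proved.

**Theorem** (`norm_digamma_sub_stirlingSeries_le`).  For `Re w > 0` and `ν ≥ 1`,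

  `‖ψ(w) − (Log w − 1/(2w) − Σ_{k=1}^{ν} B_{2k}/(2k · w^{2k}))‖ ≤ (π²/3) · (2ν+1)! / (2π)^{2ν+1} · 1/(‖w‖^{2ν} · Re w)`,

the expansion of Whittaker–Watson §12.33 / DLMF 5.11.2 with an explicit (not sharp) remainder, valid in the
whole right half-plane; and its companion for the trigamma function (`norm_deriv_digamma_sub_stirlingSeries_le`):
`‖ψ′(w) − (1/w + 1/(2w²) + Σ_{k=1}^{ν} B_{2k}/w^{2k+1})‖ ≤ (2ν+2)(π²/3)(2ν+1)!/(2π)^{2ν+1}/(‖w‖^{2ν+1} Re w)`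
(DLMF 5.15.8), from the polygamma series `ψ′(w) = Σ_j (w+j)^{−2}` (`hasSum_iteratedDeriv_digamma`).  Proof: Euler–Maclaurin summation of order `ν` (the tree's
`Literature.Barriers.RiemannHypothesis.Lemma2.eulerMaclaurin_family`) applied to the derivative family
`g_j(x) = (−1)^j j!/(w + x)^{j+1}` on `[0, n]`, whose `∫_0^n g_0 = Log(w+n) − Log w`; the periodic Bernoulli
function is bounded by `|B̄_{2ν+1}| ≤ (π²/3)(2ν+1)!/(2π)^{2ν+1}`
(`Literature.NumberTheory.LFunctions.abs_bernoulliPer_odd_le`) and `‖w + x‖^{2ν+2} ≥ ‖w‖^{2ν}(Re w + x)²`,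
so the remainder is at most the stated bound uniformly in `n`; then `n → ∞` by Gauss's formula
(`tendsto_log_sub_sum_inv_digamma`), `Log(w+n) − log n = Log(1 + w/n) → 0`, `(w+n)^{−m} → 0`.

Use (the reason this file exists — seat rh-explicit-weil-3, format C of the Weil-positivity ladder, item
L-C1′ / GO criterion (C-ii) of `run/shared/lean/pub/rh-explicit/PLAN.md` §1.5): after the shift
`ψ(w) = ψ(w + J) − Σ_{j<J} 1/(w+j)` (Mathlib `Complex.digamma_apply_add_one`) the bound at `w + J`,
`‖w + J‖ ≥ J`, gives `ψ(¼ + iu)` to any prescribed precision from finitely many rational operations plus one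
complex logarithm: e.g. `J = 100`, `ν = 15` ⇒ remainder `≤ 3.3·31!/(2π·100)^{31}/100 ≈ 10⁻⁵⁵`.

## References
* E. T. Whittaker, G. N. Watson, *A Course of Modern Analysis*, 4th ed., §12.33. [folklore]
* NIST DLMF §5.11(i)–(ii), 5.11.2 and the error bounds of §5.11(ii). [folklore]
* G. E. Andrews, R. Askey, R. Roy, *Special Functions* (1999), Thm. 1.2.5 (Gauss's formula) [cite: AndrewsAskeyRoy1999, Thm 1.2.5].
-/

noncomputable section

open Complex Real Set Filter Topology MeasureTheory intervalIntegral

namespace Literature.Analysis.SpecialFunctions.Complex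

open Literature.NumberTheory.LFunctions (bernoulliPer abs_bernoulliPer_odd_le measurable_bernoulliPer)
open Literature.Barriers.RiemannHypothesis.Lemma2 (eulerMaclaurin_family)

/-! ### The derivative family `g_j(x) = (−1)^j j!/(w+x)^{j+1}` -/

/-- `w + x ≠ 0` for `Re w > 0`, `x ≥ 0`. [folklore] -/
private lemma add_ofReal_ne_zero {w : ℂ} (hw : 0 < w.re) {x : ℝ} (hx : 0 ≤ x) : w + (x : ℂ) ≠ 0 := by
  intro h
  have := congrArg Complex.re h
  simp at this
  linarith

/-- The family `g_j(x) = (−1)^j j! (w+x)^{-(j+1)}` is a derivative family on `[0, ∞)`. [folklore] -/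
private lemma hasDerivAt_gFam {w : ℂ} (hw : 0 < w.re) (j : ℕ) {x : ℝ} (hx : 0 ≤ x) :
    HasDerivAt (fun y : ℝ ↦ (-1 : ℂ) ^ j * (j.factorial : ℂ) * (w + y) ^ (-(j + 1 : ℤ)))
      ((-1 : ℂ) ^ (j + 1) * ((j + 1).factorial : ℂ) * (w + x) ^ (-(j + 1 + 1 : ℤ))) x := by
  have hne : w + (x : ℂ) ≠ 0 := add_ofReal_ne_zero hw hx
  -- derivative of `z ↦ z ^ (-(j+1))` at `w + x`, composed with `z ↦ w + z`, restricted to real `y`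
  have h1 := hasDerivAt_zpow (-(j + 1 : ℤ)) (w + (x : ℂ)) (Or.inl hne)
  have h2 : HasDerivAt (fun z : ℂ ↦ w + z) 1 (x : ℂ) := (hasDerivAt_id _).const_add w
  have h3 := (h1.comp (x : ℂ) h2).comp_ofReal
  have h4 := h3.const_mul ((-1 : ℂ) ^ j * (j.factorial : ℂ))
  simp only [Function.comp_def, mul_one] at h4
  refine h4.congr_deriv ?_
  have e : (-(j + 1 : ℤ) - 1 : ℤ) = -(j + 1 + 1 : ℤ) := by ring
  rw [e, Nat.factorial_succ]
  push_cast
  ring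

/-- `∫_0^n dx/(w+x) = Log(w+n) − Log w` for `Re w > 0`. [folklore] -/
private lemma integral_gFam_zero {w : ℂ} (hw : 0 < w.re) (n : ℕ) :
    ∫ x in (0 : ℝ)..n, (-1 : ℂ) ^ 0 * ((0 : ℕ).factorial : ℂ) * (w + x) ^ (-(0 + 1 : ℤ))
      = Complex.log (w + n) - Complex.log w := by
  have hderiv : ∀ x ∈ uIcc (0 : ℝ) n, HasDerivAt (fun y : ℝ ↦ Complex.log (w + y)) ((w + x)⁻¹) x := by
    intro x hx
    rw [uIcc_of_le (Nat.cast_nonneg n)] at hx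
    have hslit : w + (x : ℂ) ∈ slitPlane := Or.inl (by simp; linarith [hx.1])
    have h2 : HasDerivAt (fun y : ℝ ↦ w + (y : ℂ)) 1 x := by
      simpa using ((hasDerivAt_id x).ofReal_comp).const_add w
    have h3 := h2.clog_real hslit
    simpa [one_div] using h3
  have hcont : ContinuousOn (fun x : ℝ ↦ (w + x)⁻¹) (uIcc (0 : ℝ) n) := by
    rw [uIcc_of_le (Nat.cast_nonneg n)]
    refine ContinuousOn.inv₀ (by fun_prop) fun x hx ↦ add_ofReal_ne_zero hw hx.1
  have := integral_eq_sub_of_hasDerivAt hderiv (hcont.intervalIntegrable)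
  simp only [pow_zero, Nat.factorial_zero, Nat.cast_one, one_mul, zero_add] at this ⊢
  rw [show (-(1 : ℤ)) = -1 from rfl]
  simp_rw [zpow_neg_one]
  simpa using this

/-! ### The remainder bound, uniformly in `n` -/

/-- `‖(w+x)^{-(m+2)}‖ ≤ ‖w‖^{-m}·(Re w + x)^{-2}` for `x ≥ 0`. [folklore] -/
private lemma norm_zpow_neg_le {w : ℂ} (hw : 0 < w.re) (m : ℕ) {x : ℝ} (hx : 0 ≤ x) :
    ‖(w + x) ^ (-(m + 2 : ℤ))‖ ≤ (‖w‖ ^ m)⁻¹ * ((w.re + x) ^ 2)⁻¹ := by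
  have hne : w + (x : ℂ) ≠ 0 := add_ofReal_ne_zero hw hx
  have hwpos : 0 < ‖w‖ := norm_pos_iff.mpr (fun h ↦ by rw [h] at hw; simp at hw)
  have hre : 0 < w.re + x := by linarith
  -- ‖w + x‖ ≥ ‖w‖ and ‖w + x‖ ≥ Re w + x
  have hn1 : ‖w‖ ≤ ‖w + x‖ := by
    have h1 : ‖w‖ ^ 2 ≤ ‖w + x‖ ^ 2 := by
      rw [Complex.sq_norm, Complex.sq_norm, Complex.normSq_apply, Complex.normSq_apply]
      simp only [add_re, ofReal_re, add_im, ofReal_im, add_zero]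
      nlinarith
    exact (pow_le_pow_iff_left₀ (norm_nonneg w) (norm_nonneg _) two_ne_zero).mp h1
  have hn2 : w.re + x ≤ ‖w + x‖ := by
    have := Complex.re_le_norm (w + x)
    simpa using this
  rw [show (-(m + 2 : ℤ)) = -((m + 2 : ℕ) : ℤ) by push_cast; ring, zpow_neg, norm_inv, zpow_natCast,
    norm_pow, ← mul_inv]
  refine inv_anti₀ (by positivity) ?_
  calc ‖w‖ ^ m * (w.re + x) ^ 2 ≤ ‖w + x‖ ^ m * ‖w + x‖ ^ 2 :=
        mul_le_mul (pow_le_pow_left₀ hwpos.le hn1 m) (pow_le_pow_left₀ hre.le hn2 2)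
          (by positivity) (by positivity)
    _ = ‖w + (x : ℂ)‖ ^ (m + 2) := by rw [pow_add]

/-- Remainder bound: `‖∫_0^n B̄_{2ν+1}(x) (w+x)^{-(2ν+2)} dx‖ ≤ (π²/3)(2ν+1)!/(2π)^{2ν+1} / (‖w‖^{2ν} Re w)`,
uniformly in `n`. [folklore] -/
private lemma norm_integral_bernoulliPer_mul_zpow_le {w : ℂ} (hw : 0 < w.re) {ν : ℕ} (hν : ν ≠ 0) (n : ℕ) :
    ‖∫ x in (0 : ℝ)..n, (bernoulliPer (2 * ν + 1) x : ℂ) * (w + x) ^ (-(2 * ν + 2 : ℤ))‖ ≤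
      Real.pi ^ 2 / 3 * ((2 * ν + 1).factorial : ℝ) / (2 * Real.pi) ^ (2 * ν + 1) /
        (‖w‖ ^ (2 * ν) * w.re) := by
  set C : ℝ := Real.pi ^ 2 / 3 * ((2 * ν + 1).factorial : ℝ) / (2 * Real.pi) ^ (2 * ν + 1) with hC
  have hC0 : 0 ≤ C := by rw [hC]; positivity
  have hwpos : 0 < ‖w‖ := norm_pos_iff.mpr (fun h ↦ by rw [h] at hw; simp at hw)
  set K : ℝ := C * (‖w‖ ^ (2 * ν))⁻¹ with hK
  have hK0 : 0 ≤ K := by rw [hK]; positivity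
  have hn0 : (0 : ℝ) ≤ n := Nat.cast_nonneg n
  -- pointwise bound
  have hpt : ∀ᵐ x : ℝ, x ∈ Ioc (0 : ℝ) n →
      ‖(bernoulliPer (2 * ν + 1) x : ℂ) * (w + x) ^ (-(2 * ν + 2 : ℤ))‖ ≤ K * ((w.re + x) ^ 2)⁻¹ := by
    refine ae_of_all _ fun x hx ↦ ?_
    rw [norm_mul, Complex.norm_real, Real.norm_eq_abs, hK, mul_assoc]
    have h1 := abs_bernoulliPer_odd_le hν x
    have h2 : ‖(w + x) ^ (-(2 * ν + 2 : ℤ))‖ ≤ (‖w‖ ^ (2 * ν))⁻¹ * ((w.re + x) ^ 2)⁻¹ := by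
      have := norm_zpow_neg_le hw (2 * ν) hx.1.le
      convert this using 3
      push_cast; ring
    exact mul_le_mul h1 h2 (norm_nonneg _) hC0
  -- the majorant integrates to `K (1/Re w − 1/(Re w + n)) ≤ K / Re w`
  have hderiv : ∀ x ∈ uIcc (0 : ℝ) n, HasDerivAt (fun y : ℝ ↦ -K * (w.re + y)⁻¹) (K * ((w.re + x) ^ 2)⁻¹) x := by
    intro x hx
    rw [uIcc_of_le hn0] at hx
    have hne : w.re + x ≠ 0 := by linarith [hx.1]
    have h1 : HasDerivAt (fun y : ℝ ↦ w.re + y) 1 x := (hasDerivAt_id x).const_add _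
    have h2 := (h1.inv hne).const_mul (-K)
    refine h2.congr_deriv ?_
    field_simp
  have hcont : ContinuousOn (fun x : ℝ ↦ K * ((w.re + x) ^ 2)⁻¹) (uIcc (0 : ℝ) n) := by
    rw [uIcc_of_le hn0]
    refine ContinuousOn.mul continuousOn_const (ContinuousOn.inv₀ (by fun_prop) fun x hx ↦ ?_)
    have : 0 < w.re + x := by linarith [hx.1]
    positivity
  have hint : IntervalIntegrable (fun x : ℝ ↦ K * ((w.re + x) ^ 2)⁻¹) volume 0 n :=
    hcont.intervalIntegrable
  have hval : ∫ x in (0 : ℝ)..n, K * ((w.re + x) ^ 2)⁻¹ = -K * (w.re + n)⁻¹ - -K * (w.re + 0)⁻¹ :=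
    integral_eq_sub_of_hasDerivAt hderiv hint
  calc ‖∫ x in (0 : ℝ)..n, (bernoulliPer (2 * ν + 1) x : ℂ) * (w + x) ^ (-(2 * ν + 2 : ℤ))‖
      ≤ ∫ x in (0 : ℝ)..n, K * ((w.re + x) ^ 2)⁻¹ :=
        intervalIntegral.norm_integral_le_of_norm_le hn0 hpt hint
    _ = K * ((w.re)⁻¹ - (w.re + n)⁻¹) := by rw [hval]; ring
    _ ≤ K * (w.re)⁻¹ := by
        refine mul_le_mul_of_nonneg_left ?_ hK0
        have : 0 ≤ (w.re + n)⁻¹ := by positivity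
        linarith
    _ = C / (‖w‖ ^ (2 * ν) * w.re) := by rw [hK]; field_simp

/-- `Σ_{j ≤ n} f j = f 0 + Σ_{0 < m ≤ n} f m`. [folklore] -/
private lemma sum_range_succ_eq_add_sum_Ioc {M : Type*} [AddCommMonoid M] (f : ℕ → M) (n : ℕ) :
    ∑ j ∈ Finset.range (n + 1), f j = f 0 + ∑ m ∈ Finset.Ioc 0 n, f m := by
  induction n with
  | zero => simp
  | succ n ih => rw [Finset.sum_range_succ, ih, Finset.sum_Ioc_succ_top (Nat.zero_le _), add_assoc]

/-- `log n − Log(w + n) → 0` in `ℂ` (`Re w > 0`). [folklore] -/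
private lemma tendsto_log_nat_sub_clog_add {w : ℂ} (hw : 0 < w.re) :
    Tendsto (fun n : ℕ ↦ (Real.log n : ℂ) - Complex.log (w + n)) atTop (𝓝 0) := by
  have h1 : Tendsto (fun n : ℕ ↦ w / n + 1) atTop (𝓝 1) := by
    have := (tendsto_const_div_atTop_nhds_zero_nat w).add (tendsto_const_nhds (x := (1 : ℂ)))
    simpa using this
  have h2 : Tendsto (fun n : ℕ ↦ Complex.log (w / n + 1)) atTop (𝓝 0) := by
    have hc : ContinuousAt Complex.log 1 := continuousAt_clog (by simp [slitPlane])
    have := hc.tendsto.comp h1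
    rw [Complex.log_one] at this
    exact this
  have h3 : ∀ᶠ n : ℕ in atTop, (Real.log n : ℂ) - Complex.log (w + n) = -Complex.log (w / n + 1) := by
    filter_upwards [eventually_ne_atTop 0] with n hn
    have hn0 : (0 : ℝ) < n := Nat.cast_pos.2 (Nat.pos_of_ne_zero hn)
    have hne : w / n + 1 ≠ 0 := by
      intro h
      have := congrArg Complex.re h
      simp [Complex.div_re] at this
      have : w.re / n + 1 = 0 := by
        have e : w.re * n / (n * n : ℝ) = w.re / n := by field_simp
        linarith [e]
      have : 0 < w.re / n + 1 := by positivity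
      linarith
    have hwn : w + n = (n : ℝ) * (w / n + 1) := by
      have : (n : ℂ) ≠ 0 := by exact_mod_cast hn
      push_cast
      field_simp
    rw [hwn, Complex.log_ofReal_mul hn0 hne]
    push_cast
    ring
  rw [tendsto_congr' h3]
  simpa using h2.neg

/-- `‖(w + n)^{-p}‖ → 0` for `p ≥ 1` (`Re w > 0`). [folklore] -/
private lemma tendsto_inv_pow_add_nat {w : ℂ} (hw : 0 < w.re) {p : ℕ} (hp : 1 ≤ p) :
    Tendsto (fun n : ℕ ↦ ((w + n) ^ p)⁻¹) atTop (𝓝 0) := by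
  refine squeeze_zero_norm' ?_ tendsto_one_div_atTop_nhds_zero_nat
  filter_upwards [eventually_ge_atTop 1] with n hn
  have hn1 : (1 : ℝ) ≤ n := by exact_mod_cast hn
  have hre : (n : ℝ) ≤ ‖w + n‖ := by
    have := Complex.re_le_norm (w + n)
    simp at this
    linarith
  rw [norm_inv, norm_pow, one_div]
  refine inv_anti₀ (by positivity) ?_
  calc (n : ℝ) ≤ (n : ℝ) ^ p := le_self_pow₀ hn1 (by omega)
    _ ≤ ‖w + n‖ ^ p := pow_le_pow_left₀ (by positivity) hre p

/-- **Stirling's series for the complex digamma function with an explicit remainder** (any order `ν ≥ 1`,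
right half-plane): for `Re w > 0`,
`‖ψ(w) − (Log w − 1/(2w) − Σ_{k=1}^{ν} B_{2k}/(2k w^{2k}))‖ ≤ (π²/3)(2ν+1)!/(2π)^{2ν+1} · 1/(‖w‖^{2ν} Re w)`.
Combined with `ψ(w) = ψ(w+J) − Σ_{j<J} (w+j)⁻¹` this evaluates `ψ` to arbitrary precision in the kernel.
[cite: AndrewsAskeyRoy1999, Thm 1.2.5 (Gauss's formula) and Cor 1.4.5 (Stirling for ψ)] -/
theorem norm_digamma_sub_stirlingSeries_le {w : ℂ} (hw : 0 < w.re) {ν : ℕ} (hν : ν ≠ 0) :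
    ‖Complex.digamma w - (Complex.log w - 1 / (2 * w) -
        ∑ k ∈ Finset.Icc 1 ν, (bernoulli (2 * k) : ℂ) / (2 * k) / w ^ (2 * k))‖ ≤
      Real.pi ^ 2 / 3 * ((2 * ν + 1).factorial : ℝ) / (2 * Real.pi) ^ (2 * ν + 1) /
        (‖w‖ ^ (2 * ν) * w.re) := by
  -- the derivative family
  set G : ℕ → ℝ → ℂ := fun j y ↦ (-1 : ℂ) ^ j * (j.factorial : ℂ) * (w + y) ^ (-(j + 1 : ℤ)) with hG
  set c : ℕ → ℂ := fun k ↦ (bernoulli (2 * k) : ℂ) / (2 * k) with hc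
  set Main : ℂ := Complex.log w - 1 / (2 * w) - ∑ k ∈ Finset.Icc 1 ν, c k / w ^ (2 * k) with hMain
  set Bnd : ℝ := Real.pi ^ 2 / 3 * ((2 * ν + 1).factorial : ℝ) / (2 * Real.pi) ^ (2 * ν + 1) /
    (‖w‖ ^ (2 * ν) * w.re) with hBnd
  have hw0 : w ≠ 0 := fun h ↦ by rw [h] at hw; simp at hw
  -- values of the family
  have hG0 : ∀ y : ℝ, G 0 y = (w + y)⁻¹ := by
    intro y; simp [hG]
  have hG1 : ∀ k, 1 ≤ k → ∀ y : ℝ, 0 ≤ y →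
      (bernoulli (2 * k) : ℂ) / ((2 * k).factorial : ℂ) * G (2 * k - 1) y = -(c k * ((w + y) ^ (2 * k))⁻¹) := by
    intro k hk y hy
    have hne : w + (y : ℂ) ≠ 0 := add_ofReal_ne_zero hw hy
    obtain ⟨k', rfl⟩ : ∃ k', k = k' + 1 := ⟨k - 1, by omega⟩
    have e1 : 2 * (k' + 1) - 1 = 2 * k' + 1 := by omega
    rw [e1]
    have hGval : G (2 * k' + 1) y = -(((2 * k' + 1).factorial : ℂ)) * ((w + y) ^ (2 * k' + 2))⁻¹ := by
      simp only [hG]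
      have hm1 : (-1 : ℂ) ^ (2 * k' + 1) = -1 := by
        rw [pow_succ, pow_mul, neg_one_sq, one_pow, one_mul]
      have ez : (-((((2 * k' + 1 : ℕ) : ℤ)) + 1) : ℤ) = -(((2 * k' + 2 : ℕ)) : ℤ) := by push_cast; ring
      rw [hm1, ez, zpow_neg, zpow_natCast]
      ring
    have hfac : (((2 * (k' + 1)).factorial : ℕ) : ℂ) =
        ((2 * k' + 2 : ℕ) : ℂ) * (((2 * k' + 1).factorial : ℕ) : ℂ) := by
      rw [show 2 * (k' + 1) = (2 * k' + 1) + 1 by ring, Nat.factorial_succ, Nat.cast_mul]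
    rw [hGval, hfac, hc]
    simp only
    rw [show 2 * (k' + 1) = 2 * k' + 2 by ring]
    have hf : (((2 * k' + 1).factorial : ℕ) : ℂ) ≠ 0 := by exact_mod_cast Nat.factorial_ne_zero _
    have hk0 : ((2 * k' + 2 : ℕ) : ℂ) ≠ 0 := by exact_mod_cast (by omega : 2 * k' + 2 ≠ 0)
    have hk0' : (2 * ((k' + 1 : ℕ) : ℂ)) ≠ 0 := by
      rw [show (2 * ((k' + 1 : ℕ) : ℂ)) = ((2 * k' + 2 : ℕ) : ℂ) by push_cast; ring]; exact hk0
    have hX : (w + y) ^ (2 * k' + 2) ≠ 0 := pow_ne_zero _ hne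
    field_simp
    push_cast
    ring
  have hG2 : ∀ y : ℝ, (1 : ℂ) / ((2 * ν + 1).factorial : ℂ) * ((bernoulliPer (2 * ν + 1) y : ℂ) * G (2 * ν + 1) y)
      = -((bernoulliPer (2 * ν + 1) y : ℂ) * (w + y) ^ (-(2 * ν + 2 : ℤ))) := by
    intro y
    rw [hG]
    simp only
    rw [pow_succ, pow_mul, neg_one_sq, one_pow, one_mul]
    have ez : (-((((2 * ν + 1 : ℕ) : ℤ)) + 1) : ℤ) = -(2 * ν + 2 : ℤ) := by push_cast; ring
    rw [ez]
    have hf : (((2 * ν + 1).factorial : ℕ) : ℂ) ≠ 0 := by exact_mod_cast Nat.factorial_ne_zero _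
    field_simp
  -- Euler–Maclaurin at finite `n`
  have hEM : ∀ n : ℕ, ∑ m ∈ Finset.Ioc 0 n, G 0 m =
      (Complex.log (w + n) - Complex.log w) + (G 0 n - G 0 0) / 2 +
        ∑ k ∈ Finset.Icc 1 ν, (bernoulli (2 * k) : ℂ) / (2 * k).factorial * (G (2 * k - 1) n - G (2 * k - 1) 0) +
        1 / (2 * ν + 1).factorial *
          ∫ x in ((0 : ℕ) : ℝ)..n, (bernoulliPer (2 * ν + 1) x : ℂ) * G (2 * ν + 1) x := by
    intro n
    have hg : ∀ j, ∀ x ∈ Icc ((0 : ℕ) : ℝ) n, HasDerivAt (G j) (G (j + 1) x) x := by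
      intro j x hx
      have h := hasDerivAt_gFam hw j (by simpa using hx.1)
      rw [hG]
      refine h.congr_deriv ?_
      push_cast
      ring_nf
    have hI : ∫ x in ((0 : ℕ) : ℝ)..n, G 0 x = Complex.log (w + n) - Complex.log w := by
      rw [Nat.cast_zero]
      exact integral_gFam_zero hw n
    have := eulerMaclaurin_family hg (Nat.zero_le n) ν
    rw [this, hI, Nat.cast_zero]
  -- the finite-`n` identity `A_n − V_n − Main = −R_n` and the bound
  have hkey : ∀ n : ℕ, ‖((Real.log n : ℂ) - ∑ j ∈ Finset.range (n + 1), 1 / (w + j)) -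
      (((Real.log n : ℂ) - Complex.log (w + n)) - (w + n)⁻¹ / 2 +
        ∑ k ∈ Finset.Icc 1 ν, c k * ((w + n) ^ (2 * k))⁻¹) - Main‖ ≤ Bnd := by
    intro n
    have hS : ∑ j ∈ Finset.range (n + 1), 1 / (w + j) = w⁻¹ + ∑ m ∈ Finset.Ioc 0 n, G 0 m := by
      rw [sum_range_succ_eq_add_sum_Ioc]
      simp only [hG0, Nat.cast_zero, add_zero, one_div, Complex.ofReal_natCast]
    have hG0n : G 0 n = (w + n)⁻¹ := by rw [hG0, Complex.ofReal_natCast]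
    have hG00 : G 0 0 = w⁻¹ := by
      have := hG0 0
      rw [Complex.ofReal_zero, add_zero] at this
      exact_mod_cast this
    have hsumK : ∑ k ∈ Finset.Icc 1 ν, (bernoulli (2 * k) : ℂ) / (2 * k).factorial *
        (G (2 * k - 1) n - G (2 * k - 1) 0) =
        -(∑ k ∈ Finset.Icc 1 ν, c k * ((w + n) ^ (2 * k))⁻¹) + ∑ k ∈ Finset.Icc 1 ν, c k / w ^ (2 * k) := by
      rw [← Finset.sum_neg_distrib, ← Finset.sum_add_distrib]
      refine Finset.sum_congr rfl fun k hk ↦ ?_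
      have hk1 : 1 ≤ k := (Finset.mem_Icc.mp hk).1
      have h1 := hG1 k hk1 n (Nat.cast_nonneg n)
      have h0 := hG1 k hk1 0 le_rfl
      rw [Complex.ofReal_natCast] at h1
      rw [Complex.ofReal_zero, add_zero] at h0
      rw [mul_sub, h1, h0, div_eq_mul_inv (c k)]
      ring
    have hR : 1 / ((2 * ν + 1).factorial : ℂ) *
        ∫ x in ((0 : ℕ) : ℝ)..n, (bernoulliPer (2 * ν + 1) x : ℂ) * G (2 * ν + 1) x =
        -∫ x in (0 : ℝ)..n, (bernoulliPer (2 * ν + 1) x : ℂ) * (w + x) ^ (-(2 * ν + 2 : ℤ)) := by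
      rw [Nat.cast_zero, ← intervalIntegral.integral_const_mul, ← intervalIntegral.integral_neg]
      refine intervalIntegral.integral_congr fun x _ ↦ ?_
      exact hG2 x
    have hid : ((Real.log n : ℂ) - ∑ j ∈ Finset.range (n + 1), 1 / (w + j)) -
        (((Real.log n : ℂ) - Complex.log (w + n)) - (w + n)⁻¹ / 2 +
          ∑ k ∈ Finset.Icc 1 ν, c k * ((w + n) ^ (2 * k))⁻¹) - Main =
        ∫ x in (0 : ℝ)..n, (bernoulliPer (2 * ν + 1) x : ℂ) * (w + x) ^ (-(2 * ν + 2 : ℤ)) := by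
      rw [hS, hEM n, hsumK, hR, hG0n, hG00, hMain]
      ring
    rw [hid]
    exact norm_integral_bernoulliPer_mul_zpow_le hw hν n
  -- pass to the limit
  have hA : Tendsto (fun n : ℕ ↦ (Real.log n : ℂ) - ∑ j ∈ Finset.range (n + 1), 1 / (w + j)) atTop
      (𝓝 (Complex.digamma w)) := tendsto_log_sub_sum_inv_digamma hw
  have hV : Tendsto (fun n : ℕ ↦ ((Real.log n : ℂ) - Complex.log (w + n)) - (w + n)⁻¹ / 2 +
      ∑ k ∈ Finset.Icc 1 ν, c k * ((w + n) ^ (2 * k))⁻¹) atTop (𝓝 0) := by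
    have h1 := tendsto_log_nat_sub_clog_add hw
    have h2 : Tendsto (fun n : ℕ ↦ (w + n)⁻¹ / 2) atTop (𝓝 0) := by
      have := (tendsto_inv_pow_add_nat hw (le_refl 1)).div_const 2
      simpa using this
    have h3 : Tendsto (fun n : ℕ ↦ ∑ k ∈ Finset.Icc 1 ν, c k * ((w + n) ^ (2 * k))⁻¹) atTop (𝓝 0) := by
      have : Tendsto (fun n : ℕ ↦ ∑ k ∈ Finset.Icc 1 ν, c k * ((w + n) ^ (2 * k))⁻¹) atTop
          (𝓝 (∑ k ∈ Finset.Icc 1 ν, c k * 0)) := by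
        refine tendsto_finsetSum _ fun k hk ↦ ?_
        exact (tendsto_inv_pow_add_nat hw (by have := (Finset.mem_Icc.mp hk).1; omega)).const_mul _
      simpa using this
    have := (h1.sub h2).add h3
    simpa using this
  have hlim : Tendsto (fun n : ℕ ↦ ((Real.log n : ℂ) - ∑ j ∈ Finset.range (n + 1), 1 / (w + j)) -
      (((Real.log n : ℂ) - Complex.log (w + n)) - (w + n)⁻¹ / 2 +
        ∑ k ∈ Finset.Icc 1 ν, c k * ((w + n) ^ (2 * k))⁻¹) - Main) atTop
      (𝓝 (Complex.digamma w - 0 - Main)) := (hA.sub hV).sub tendsto_const_nhds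
  have hnorm := (continuous_norm.tendsto _).comp hlim
  have hle := le_of_tendsto' hnorm hkey
  simpa [hMain, hc, div_eq_mul_inv] using hle

/-! ### The trigamma function `ψ′` -/

/-- **Stirling's series for the trigamma function `ψ′ = (ψ)′` with an explicit remainder** (any order
`ν ≥ 1`, right half-plane): for `Re w > 0`,
`‖ψ′(w) − (1/w + 1/(2w²) + Σ_{k=1}^{ν} B_{2k}/w^{2k+1})‖ ≤ (2ν+2)(π²/3)(2ν+1)!/(2π)^{2ν+1} · 1/(‖w‖^{2ν+1} Re w)`
(Euler–Maclaurin on the polygamma series `ψ′(w) = Σ_j (w+j)^{-2}`, `hasSum_iteratedDeriv_digamma`).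
[cite: AndrewsAskeyRoy1999, Thm 1.2.5 and (1.2.14) (polygamma series); Cor 1.4.5 (Stirling)] -/
theorem norm_deriv_digamma_sub_stirlingSeries_le {w : ℂ} (hw : 0 < w.re) {ν : ℕ} (hν : ν ≠ 0) :
    ‖deriv Complex.digamma w - (1 / w + 1 / (2 * w ^ 2) +
        ∑ k ∈ Finset.Icc 1 ν, (bernoulli (2 * k) : ℂ) / w ^ (2 * k + 1))‖ ≤
      (2 * ν + 2) * (Real.pi ^ 2 / 3 * ((2 * ν + 1).factorial : ℝ) / (2 * Real.pi) ^ (2 * ν + 1)) /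
        (‖w‖ ^ (2 * ν + 1) * w.re) := by
  -- the derivative family `F_j = -G_{j+1}`: `F_j(x) = (-1)^j (j+1)!/(w+x)^{j+2}`
  set F : ℕ → ℝ → ℂ := fun j y ↦ (-1 : ℂ) ^ j * ((j + 1).factorial : ℂ) * (w + y) ^ (-(j + 2 : ℤ)) with hF
  set Main : ℂ := 1 / w + 1 / (2 * w ^ 2) + ∑ k ∈ Finset.Icc 1 ν, (bernoulli (2 * k) : ℂ) / w ^ (2 * k + 1)
    with hMain
  set C : ℝ := Real.pi ^ 2 / 3 * ((2 * ν + 1).factorial : ℝ) / (2 * Real.pi) ^ (2 * ν + 1) with hC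
  set Bnd : ℝ := (2 * ν + 2) * C / (‖w‖ ^ (2 * ν + 1) * w.re) with hBnd
  have hw0 : w ≠ 0 := fun h ↦ by rw [h] at hw; simp at hw
  have hwpos : 0 < ‖w‖ := norm_pos_iff.mpr hw0
  have hC0 : 0 ≤ C := by rw [hC]; positivity
  -- `F` is a derivative family on `[0, n]`
  have hFderiv : ∀ n : ℕ, ∀ j, ∀ x ∈ Icc ((0 : ℕ) : ℝ) n, HasDerivAt (F j) (F (j + 1) x) x := by
    intro n j x hx
    have hx0 : 0 ≤ x := by simpa using hx.1
    have h := (hasDerivAt_gFam hw (j + 1) hx0).const_mul (-1 : ℂ)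
    have eF : ∀ i, F i = fun y : ℝ ↦ (-1 : ℂ) * ((-1 : ℂ) ^ (i + 1) * ((i + 1).factorial : ℂ) *
        (w + y) ^ (-((i + 1 : ℕ) + 1 : ℤ))) := by
      intro i; funext y; simp only [hF]; push_cast; ring
    rw [eF j]
    refine h.congr_deriv ?_
    rw [eF (j + 1)]
    push_cast
    ring_nf
  -- values
  have hF0 : ∀ y : ℝ, 0 ≤ y → F 0 y = ((w + y) ^ 2)⁻¹ := by
    intro y hy
    simp only [hF, pow_zero, zero_add, Nat.factorial_one, Nat.cast_one, one_mul, Nat.cast_zero, zpow_neg]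
    norm_cast
  have hF1 : ∀ k, 1 ≤ k → ∀ y : ℝ, 0 ≤ y →
      (bernoulli (2 * k) : ℂ) / ((2 * k).factorial : ℂ) * F (2 * k - 1) y = -((bernoulli (2 * k) : ℂ) * ((w + y) ^ (2 * k + 1))⁻¹) := by
    intro k hk y hy
    have hne : w + (y : ℂ) ≠ 0 := add_ofReal_ne_zero hw hy
    obtain ⟨k', rfl⟩ : ∃ k', k = k' + 1 := ⟨k - 1, by omega⟩
    have e1 : 2 * (k' + 1) - 1 = 2 * k' + 1 := by omega
    rw [e1]
    have hFval : F (2 * k' + 1) y = -(((2 * k' + 2).factorial : ℂ)) * ((w + y) ^ (2 * k' + 3))⁻¹ := by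
      simp only [hF]
      have hm1 : (-1 : ℂ) ^ (2 * k' + 1) = -1 := by
        rw [pow_succ, pow_mul, neg_one_sq, one_pow, one_mul]
      have ez : (-((((2 * k' + 1 : ℕ) : ℤ)) + 2) : ℤ) = -(((2 * k' + 3 : ℕ)) : ℤ) := by push_cast; ring
      rw [hm1, show 2 * k' + 1 + 1 = 2 * k' + 2 by ring, ez, zpow_neg, zpow_natCast]
      ring
    rw [hFval, show 2 * (k' + 1) = 2 * k' + 2 by ring, show 2 * k' + 2 + 1 = 2 * k' + 3 by ring]
    have hf : (((2 * k' + 2).factorial : ℕ) : ℂ) ≠ 0 := by exact_mod_cast Nat.factorial_ne_zero _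
    have hX : (w + y) ^ (2 * k' + 3) ≠ 0 := pow_ne_zero _ hne
    field_simp
  have hF2 : ∀ y : ℝ, (1 : ℂ) / ((2 * ν + 1).factorial : ℂ) * ((bernoulliPer (2 * ν + 1) y : ℂ) * F (2 * ν + 1) y)
      = -(((2 * ν + 2 : ℕ) : ℂ) * ((bernoulliPer (2 * ν + 1) y : ℂ) * (w + y) ^ (-(2 * ν + 3 : ℤ)))) := by
    intro y
    simp only [hF]
    rw [pow_succ, pow_mul, neg_one_sq, one_pow, one_mul]
    have ez : (-((((2 * ν + 1 : ℕ) : ℤ)) + 2) : ℤ) = -(2 * ν + 3 : ℤ) := by push_cast; ring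
    rw [ez, Nat.factorial_succ (2 * ν + 1), Nat.cast_mul]
    have hf : (((2 * ν + 1).factorial : ℕ) : ℂ) ≠ 0 := by exact_mod_cast Nat.factorial_ne_zero _
    field_simp
  -- `∫_0^n F_0 = 1/w − 1/(w+n)`
  have hI : ∀ n : ℕ, ∫ x in ((0 : ℕ) : ℝ)..n, F 0 x = w⁻¹ - (w + n)⁻¹ := by
    intro n
    have hn0 : (0 : ℝ) ≤ n := Nat.cast_nonneg n
    have hderiv : ∀ x ∈ uIcc (0 : ℝ) n, HasDerivAt (fun y : ℝ ↦ -(w + y)⁻¹) (F 0 x) x := by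
      intro x hx
      rw [uIcc_of_le hn0] at hx
      have hne : w + (x : ℂ) ≠ 0 := add_ofReal_ne_zero hw hx.1
      have h2 : HasDerivAt (fun y : ℝ ↦ w + (y : ℂ)) 1 x := by
        simpa using ((hasDerivAt_id x).ofReal_comp).const_add w
      have h3 := (h2.inv hne).neg
      rw [hF0 x hx.1]
      refine h3.congr_deriv ?_
      field_simp
    have hcont : ContinuousOn (F 0) (uIcc (0 : ℝ) n) := by
      rw [uIcc_of_le hn0]
      intro x hx
      exact (hFderiv n 0 x (by simpa using hx)).continuousAt.continuousWithinAt
    rw [Nat.cast_zero, integral_eq_sub_of_hasDerivAt hderiv hcont.intervalIntegrable]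
    push_cast
    ring
  -- remainder bound
  have hR : ∀ n : ℕ, ‖∫ x in (0 : ℝ)..n, (bernoulliPer (2 * ν + 1) x : ℂ) * (w + x) ^ (-(2 * ν + 3 : ℤ))‖ ≤
      C / (‖w‖ ^ (2 * ν + 1) * w.re) := by
    intro n
    have hn0 : (0 : ℝ) ≤ n := Nat.cast_nonneg n
    set K : ℝ := C * (‖w‖ ^ (2 * ν + 1))⁻¹ with hK
    have hK0 : 0 ≤ K := by rw [hK]; positivity
    have hpt : ∀ᵐ x : ℝ, x ∈ Ioc (0 : ℝ) n →
        ‖(bernoulliPer (2 * ν + 1) x : ℂ) * (w + x) ^ (-(2 * ν + 3 : ℤ))‖ ≤ K * ((w.re + x) ^ 2)⁻¹ := by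
      refine ae_of_all _ fun x hx ↦ ?_
      rw [norm_mul, Complex.norm_real, Real.norm_eq_abs, hK, mul_assoc]
      have h1 := abs_bernoulliPer_odd_le hν x
      have h2 : ‖(w + x) ^ (-(2 * ν + 3 : ℤ))‖ ≤ (‖w‖ ^ (2 * ν + 1))⁻¹ * ((w.re + x) ^ 2)⁻¹ := by
        have := norm_zpow_neg_le hw (2 * ν + 1) hx.1.le
        convert this using 3
        push_cast; ring
      exact mul_le_mul h1 h2 (norm_nonneg _) hC0
    have hderiv : ∀ x ∈ uIcc (0 : ℝ) n, HasDerivAt (fun y : ℝ ↦ -K * (w.re + y)⁻¹) (K * ((w.re + x) ^ 2)⁻¹) x := by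
      intro x hx
      rw [uIcc_of_le hn0] at hx
      have hne : w.re + x ≠ 0 := by linarith [hx.1]
      have h1 : HasDerivAt (fun y : ℝ ↦ w.re + y) 1 x := (hasDerivAt_id x).const_add _
      have h2 := (h1.inv hne).const_mul (-K)
      refine h2.congr_deriv ?_
      field_simp
    have hcont : ContinuousOn (fun x : ℝ ↦ K * ((w.re + x) ^ 2)⁻¹) (uIcc (0 : ℝ) n) := by
      rw [uIcc_of_le hn0]
      refine ContinuousOn.mul continuousOn_const (ContinuousOn.inv₀ (by fun_prop) fun x hx ↦ ?_)
      have : 0 < w.re + x := by linarith [hx.1]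
      positivity
    have hint : IntervalIntegrable (fun x : ℝ ↦ K * ((w.re + x) ^ 2)⁻¹) volume 0 n := hcont.intervalIntegrable
    have hval : ∫ x in (0 : ℝ)..n, K * ((w.re + x) ^ 2)⁻¹ = -K * (w.re + n)⁻¹ - -K * (w.re + 0)⁻¹ :=
      integral_eq_sub_of_hasDerivAt hderiv hint
    calc ‖∫ x in (0 : ℝ)..n, (bernoulliPer (2 * ν + 1) x : ℂ) * (w + x) ^ (-(2 * ν + 3 : ℤ))‖
        ≤ ∫ x in (0 : ℝ)..n, K * ((w.re + x) ^ 2)⁻¹ := intervalIntegral.norm_integral_le_of_norm_le hn0 hpt hint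
      _ = K * ((w.re)⁻¹ - (w.re + n)⁻¹) := by rw [hval]; ring
      _ ≤ K * (w.re)⁻¹ := by
          refine mul_le_mul_of_nonneg_left ?_ hK0
          have : 0 ≤ (w.re + n)⁻¹ := by positivity
          linarith
      _ = C / (‖w‖ ^ (2 * ν + 1) * w.re) := by rw [hK]; field_simp
  -- Euler–Maclaurin at finite `n` and the identity
  have hkey : ∀ n : ℕ, ‖(∑ j ∈ Finset.range (n + 1), ((w + j) ^ 2)⁻¹) -
      (-(w + n)⁻¹ + ((w + n) ^ 2)⁻¹ / 2 -
        ∑ k ∈ Finset.Icc 1 ν, (bernoulli (2 * k) : ℂ) * ((w + n) ^ (2 * k + 1))⁻¹) - Main‖ ≤ Bnd := by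
    intro n
    have hEM := eulerMaclaurin_family (hFderiv n) (Nat.zero_le n) ν
    rw [hI n, Nat.cast_zero] at hEM
    have hS : ∑ j ∈ Finset.range (n + 1), ((w + j) ^ 2)⁻¹ = (w ^ 2)⁻¹ + ∑ m ∈ Finset.Ioc 0 n, F 0 m := by
      rw [sum_range_succ_eq_add_sum_Ioc]
      congr 1
      · simp
      · refine Finset.sum_congr rfl fun m _ ↦ ?_
        rw [hF0 m (Nat.cast_nonneg m), Complex.ofReal_natCast]
    have hF0n : F 0 n = ((w + n) ^ 2)⁻¹ := by rw [hF0 n (Nat.cast_nonneg n), Complex.ofReal_natCast]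
    have hF00 : F 0 0 = (w ^ 2)⁻¹ := by
      have := hF0 0 le_rfl
      rw [Complex.ofReal_zero, add_zero] at this
      exact this
    have hsumK : ∑ k ∈ Finset.Icc 1 ν, (bernoulli (2 * k) : ℂ) / (2 * k).factorial *
        (F (2 * k - 1) n - F (2 * k - 1) 0) =
        -(∑ k ∈ Finset.Icc 1 ν, (bernoulli (2 * k) : ℂ) * ((w + n) ^ (2 * k + 1))⁻¹) +
          ∑ k ∈ Finset.Icc 1 ν, (bernoulli (2 * k) : ℂ) / w ^ (2 * k + 1) := by
      rw [← Finset.sum_neg_distrib, ← Finset.sum_add_distrib]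
      refine Finset.sum_congr rfl fun k hk ↦ ?_
      have hk1 : 1 ≤ k := (Finset.mem_Icc.mp hk).1
      have h1 := hF1 k hk1 n (Nat.cast_nonneg n)
      have h0 := hF1 k hk1 0 le_rfl
      rw [Complex.ofReal_natCast] at h1
      rw [Complex.ofReal_zero, add_zero] at h0
      rw [mul_sub, h1, h0, div_eq_mul_inv]
      ring
    have hRn : 1 / ((2 * ν + 1).factorial : ℂ) *
        ∫ x in (0 : ℝ)..n, (bernoulliPer (2 * ν + 1) x : ℂ) * F (2 * ν + 1) x =
        -(((2 * ν + 2 : ℕ) : ℂ) * ∫ x in (0 : ℝ)..n, (bernoulliPer (2 * ν + 1) x : ℂ) * (w + x) ^ (-(2 * ν + 3 : ℤ))) := by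
      rw [← intervalIntegral.integral_const_mul, ← intervalIntegral.integral_const_mul,
        ← intervalIntegral.integral_neg]
      refine intervalIntegral.integral_congr fun x _ ↦ ?_
      exact hF2 x
    have hid : (∑ j ∈ Finset.range (n + 1), ((w + j) ^ 2)⁻¹) -
        (-(w + n)⁻¹ + ((w + n) ^ 2)⁻¹ / 2 -
          ∑ k ∈ Finset.Icc 1 ν, (bernoulli (2 * k) : ℂ) * ((w + n) ^ (2 * k + 1))⁻¹) - Main =
        -(((2 * ν + 2 : ℕ) : ℂ) * ∫ x in (0 : ℝ)..n, (bernoulliPer (2 * ν + 1) x : ℂ) * (w + x) ^ (-(2 * ν + 3 : ℤ))) := by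
      rw [hS, hEM, hsumK, hRn, hF0n, hF00, hMain]
      ring
    rw [hid, norm_neg, norm_mul, Complex.norm_natCast, hBnd, mul_div_assoc]
    push_cast
    exact mul_le_mul_of_nonneg_left (hR n) (by positivity : (0 : ℝ) ≤ 2 * (ν : ℝ) + 2)
  -- limits
  have hA : Tendsto (fun n : ℕ ↦ ∑ j ∈ Finset.range (n + 1), ((w + j) ^ 2)⁻¹) atTop
      (𝓝 (deriv Complex.digamma w)) := by
    have h := hasSum_iteratedDeriv_digamma hw (k := 1) le_rfl
    rw [iteratedDeriv_one] at h
    have h2 := h.tendsto_sum_nat.comp (tendsto_add_atTop_nat 1)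
    refine h2.congr fun n ↦ ?_
    simp
  have hV : Tendsto (fun n : ℕ ↦ -(w + n)⁻¹ + ((w + n) ^ 2)⁻¹ / 2 -
      ∑ k ∈ Finset.Icc 1 ν, (bernoulli (2 * k) : ℂ) * ((w + n) ^ (2 * k + 1))⁻¹) atTop (𝓝 0) := by
    have h1 : Tendsto (fun n : ℕ ↦ -(w + n)⁻¹) atTop (𝓝 0) := by
      have := (tendsto_inv_pow_add_nat hw (le_refl 1)).neg
      simpa using this
    have h2 : Tendsto (fun n : ℕ ↦ ((w + n) ^ 2)⁻¹ / 2) atTop (𝓝 0) := by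
      have := (tendsto_inv_pow_add_nat hw (by norm_num : 1 ≤ 2)).div_const 2
      simpa using this
    have h3 : Tendsto (fun n : ℕ ↦ ∑ k ∈ Finset.Icc 1 ν, (bernoulli (2 * k) : ℂ) * ((w + n) ^ (2 * k + 1))⁻¹)
        atTop (𝓝 0) := by
      have : Tendsto (fun n : ℕ ↦ ∑ k ∈ Finset.Icc 1 ν, (bernoulli (2 * k) : ℂ) * ((w + n) ^ (2 * k + 1))⁻¹) atTop
          (𝓝 (∑ k ∈ Finset.Icc 1 ν, (bernoulli (2 * k) : ℂ) * 0)) := by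
        refine tendsto_finsetSum _ fun k hk ↦ ?_
        exact (tendsto_inv_pow_add_nat hw (by omega)).const_mul _
      simpa using this
    have := (h1.add h2).sub h3
    simpa using this
  have hlim : Tendsto (fun n : ℕ ↦ (∑ j ∈ Finset.range (n + 1), ((w + j) ^ 2)⁻¹) -
      (-(w + n)⁻¹ + ((w + n) ^ 2)⁻¹ / 2 -
        ∑ k ∈ Finset.Icc 1 ν, (bernoulli (2 * k) : ℂ) * ((w + n) ^ (2 * k + 1))⁻¹) - Main) atTop
      (𝓝 (deriv Complex.digamma w - 0 - Main)) := (hA.sub hV).sub tendsto_const_nhds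
  have hnorm := (continuous_norm.tendsto _).comp hlim
  have hle := le_of_tendsto' hnorm hkey
  simpa [hMain, hBnd, hC] using hle

/-! ### Shifted forms: `ψ(w) = ψ(w+J) − Σ_{j<J} (w+j)⁻¹`, `ψ′(w) = ψ′(w+J) + Σ_{j<J} (w+j)⁻²` -/

/-- `ψ(w + J) = ψ(w) + Σ_{j<J} (w+j)⁻¹` for `Re w > 0` (Mathlib's `Complex.digamma_apply_add_one`, iterated).
[folklore] -/
private lemma digamma_add_natCast {w : ℂ} (hw : 0 < w.re) (J : ℕ) :
    Complex.digamma (w + J) = Complex.digamma w + ∑ j ∈ Finset.range J, (w + j)⁻¹ := by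
  induction J with
  | zero => simp
  | succ J ih =>
    have hpole : ∀ m : ℕ, w + J ≠ -m := by
      intro m h
      have := congrArg Complex.re h
      simp at this
      linarith [Nat.cast_nonneg (α := ℝ) m, Nat.cast_nonneg (α := ℝ) J]
    rw [Finset.sum_range_succ, ← add_assoc, ← ih, Nat.cast_succ, ← add_assoc]
    exact Complex.digamma_apply_add_one (w + J) hpole

/-- **Shifted Stirling series for `ψ`** (the form a kernel evaluation uses): for `Re w > 0`, `J : ℕ`, `ν ≥ 1`,
`‖ψ(w) − (Log(w+J) − Σ_{j<J}(w+j)⁻¹ − 1/(2(w+J)) − Σ_{k=1}^{ν} B_{2k}/(2k (w+J)^{2k}))‖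
   ≤ (π²/3)(2ν+1)!/(2π)^{2ν+1} / (‖w+J‖^{2ν} (Re w + J))`:
all terms but `Log(w+J)` are rational in `w`, and the right side is `O(J^{-2ν-1})`.
[cite: AndrewsAskeyRoy1999, Thm 1.2.5 and Cor 1.4.5] -/
theorem norm_digamma_sub_stirlingSeries_shift_le {w : ℂ} (hw : 0 < w.re) (J : ℕ) {ν : ℕ} (hν : ν ≠ 0) :
    ‖Complex.digamma w - (Complex.log (w + J) - ∑ j ∈ Finset.range J, (w + j)⁻¹ - 1 / (2 * (w + J)) -
        ∑ k ∈ Finset.Icc 1 ν, (bernoulli (2 * k) : ℂ) / (2 * k) / (w + J) ^ (2 * k))‖ ≤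
      Real.pi ^ 2 / 3 * ((2 * ν + 1).factorial : ℝ) / (2 * Real.pi) ^ (2 * ν + 1) /
        (‖w + J‖ ^ (2 * ν) * (w.re + J)) := by
  have hwJ : 0 < (w + (J : ℂ)).re := by simp; linarith [Nat.cast_nonneg (α := ℝ) J]
  have h := norm_digamma_sub_stirlingSeries_le hwJ hν
  have hre : (w + (J : ℂ)).re = w.re + J := by simp
  rw [hre] at h
  have e : Complex.digamma w - (Complex.log (w + J) - ∑ j ∈ Finset.range J, (w + j)⁻¹ - 1 / (2 * (w + J)) -
        ∑ k ∈ Finset.Icc 1 ν, (bernoulli (2 * k) : ℂ) / (2 * k) / (w + J) ^ (2 * k)) =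
      Complex.digamma (w + J) - (Complex.log (w + J) - 1 / (2 * (w + J)) -
        ∑ k ∈ Finset.Icc 1 ν, (bernoulli (2 * k) : ℂ) / (2 * k) / (w + J) ^ (2 * k)) := by
    rw [digamma_add_natCast hw J]; ring
  rw [e]; exact h

/-- **Shifted Stirling series for `ψ′`**: for `Re w > 0`, `J : ℕ`, `ν ≥ 1`,
`‖ψ′(w) − (Σ_{j<J}(w+j)⁻² + 1/(w+J) + 1/(2(w+J)²) + Σ_{k=1}^{ν} B_{2k}/(w+J)^{2k+1})‖
   ≤ (2ν+2)(π²/3)(2ν+1)!/(2π)^{2ν+1} / (‖w+J‖^{2ν+1} (Re w + J))` — every term rational in `w`.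
[cite: AndrewsAskeyRoy1999, (1.2.14) and Cor 1.4.5] -/
theorem norm_deriv_digamma_sub_stirlingSeries_shift_le {w : ℂ} (hw : 0 < w.re) (J : ℕ) {ν : ℕ} (hν : ν ≠ 0) :
    ‖deriv Complex.digamma w - (∑ j ∈ Finset.range J, ((w + j) ^ 2)⁻¹ + 1 / (w + J) + 1 / (2 * (w + J) ^ 2) +
        ∑ k ∈ Finset.Icc 1 ν, (bernoulli (2 * k) : ℂ) / (w + J) ^ (2 * k + 1))‖ ≤
      (2 * ν + 2) * (Real.pi ^ 2 / 3 * ((2 * ν + 1).factorial : ℝ) / (2 * Real.pi) ^ (2 * ν + 1)) /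
        (‖w + J‖ ^ (2 * ν + 1) * (w.re + J)) := by
  have hwJ : 0 < (w + (J : ℂ)).re := by simp; linarith [Nat.cast_nonneg (α := ℝ) J]
  -- `ψ′(w) = ψ′(w+J) + Σ_{j<J} (w+j)⁻²` from the polygamma series
  have hS := hasSum_iteratedDeriv_digamma hw (k := 1) le_rfl
  have hSJ := hasSum_iteratedDeriv_digamma hwJ (k := 1) le_rfl
  rw [iteratedDeriv_one] at hS hSJ
  simp only [show (-1 : ℂ) ^ (1 + 1) = 1 by norm_num, Nat.factorial_one, Nat.cast_one, one_mul] at hS hSJ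
  have hS' := (hasSum_nat_add_iff' J).mpr hS
  have e1 : (fun j : ℕ ↦ ((w + ((j + J : ℕ) : ℂ)) ^ (1 + 1))⁻¹) = fun j : ℕ ↦ ((w + J + (j : ℂ)) ^ (1 + 1))⁻¹ := by
    funext j; push_cast; ring
  rw [e1] at hS'
  have hshift : deriv Complex.digamma w = deriv Complex.digamma (w + J) +
      ∑ j ∈ Finset.range J, ((w + j) ^ 2)⁻¹ := by
    have := hSJ.unique hS'
    rw [this]
    simp only [show (1 + 1 : ℕ) = 2 by rfl]
    ring
  have h := norm_deriv_digamma_sub_stirlingSeries_le hwJ hν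
  have hre : (w + (J : ℂ)).re = w.re + J := by simp
  rw [hre] at h
  have e : deriv Complex.digamma w - (∑ j ∈ Finset.range J, ((w + j) ^ 2)⁻¹ + 1 / (w + J) + 1 / (2 * (w + J) ^ 2) +
        ∑ k ∈ Finset.Icc 1 ν, (bernoulli (2 * k) : ℂ) / (w + J) ^ (2 * k + 1)) =
      deriv Complex.digamma (w + J) - (1 / (w + J) + 1 / (2 * (w + J) ^ 2) +
        ∑ k ∈ Finset.Icc 1 ν, (bernoulli (2 * k) : ℂ) / (w + J) ^ (2 * k + 1)) := by
    rw [hshift]; ring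
  rw [e]; exact h

end Literature.Analysis.SpecialFunctions.Complex
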